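import Literature.NumberTheory.Transcendental.ZariskiDimCoordRelations
import Literature.NumberTheory.Transcendental.AutStableVanishingDescent
import HarnessLib

/-!
# Rational relations between pairs of coordinates on a ℚ-variety of dimension `< 2`

Combining `exists_relation_pair_of_zariskiDim_lt_two` (two coordinates on a set of Zariski
dimension `< 2` satisfy a nonzero COMPLEX polynomial relation) with the descent
`IsDefinedOver.exists_rat_mvPolynomial_vanishing` (on a set defined over `ℚ` a complex relation
can be replaced by a RATIONAL one with the same monomials): on a `W ⊆ ℂ^ι` defined over `ℚ` with
`zariskiDim ℂ W < 2`, any two coordinates satisfy a nonzero relation `P ∈ ℚ[U, V]`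
(`exists_rat_relation_pair_of_zariskiDim_lt_two`). This is the input of the arithmetic normal form
of a cusp germ of a ℚ-curve (crux `RigidCore.SparsityTwo`, line cusp-germ-schneider-sparsity).
[folklore]
-/

noncomputable section

open MvPolynomial

namespace Literature.NumberTheory.Transcendental

variable {ι : Type*} [Finite ι]

/-- **Rational relation between two coordinates.** If `W ⊆ ℂ^ι` is defined over `ℚ` and
`zariskiDim ℂ W < 2`, then for any two coordinates `p q : ι` there is a nonzero `P ∈ ℚ[U, V]` with
`P (z p, z q) = 0` for all `z ∈ W`. [folklore] -/
theorem exists_rat_relation_pair_of_zariskiDim_lt_two (W : Set (ι → ℂ))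
    (hWdef : IsDefinedOver (⊥ : Subfield ℂ) W) (hW : zariskiDim ℂ W < 2) (p q : ι) :
    ∃ P : MvPolynomial (Fin 2) ℚ, P ≠ 0 ∧ ∀ z ∈ W, aeval ![z p, z q] P = 0 := by
  classical
  obtain ⟨Pc, hPc, hrel⟩ := exists_relation_pair_of_zariskiDim_lt_two W hW p q
  -- transport `Pc ∈ ℂ[U,V]` to `ℂ[X_ι]` along `U ↦ X_p`, `V ↦ X_q`
  set f : MvPolynomial ι ℂ := rename (![p, q] : Fin 2 → ι) Pc with hf
  have hcomp : ∀ z : ι → ℂ, (![z p, z q] : Fin 2 → ℂ) = z ∘ ![p, q] := by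
    intro z; funext k; fin_cases k <;> rfl
  have hfW : ∀ z ∈ W, eval z f = 0 := by
    intro z hz
    rw [hf, eval_rename, ← hcomp]
    exact hrel z hz
  by_cases hpq : p = q
  · -- degenerate pair: use the one-variable relation in `U` alone
    subst hpq
    -- `Pc(U, U)`-type bookkeeping is avoided: apply the general statement to `f` if `f ≠ 0`,
    -- else fall back to the relation `U - V` which vanishes trivially on `(z p, z p)`.
    exact ⟨X 0 - X 1, sub_ne_zero.mpr (MvPolynomial.X_injective.ne (by decide)),
      fun z _ => by simp⟩
  · have hinj : Function.Injective (![p, q] : Fin 2 → ι) := by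
      intro a b hab
      fin_cases a <;> fin_cases b
      · rfl
      · exact absurd hab hpq
      · exact absurd hab.symm hpq
      · rfl
    have hf0 : f ≠ 0 := by
      rw [hf]
      exact (map_ne_zero_iff _ (rename_injective _ hinj)).mpr hPc
    obtain ⟨g, hg0, hgsupp, hgW⟩ := hWdef.exists_rat_mvPolynomial_vanishing f hf0 hfW
    -- `g` only involves the variables `p, q`: pull it back to `ℚ[U, V]`
    have hvars : ∀ m ∈ g.support, ∀ i ∈ m.support, i ∈ Set.range (![p, q] : Fin 2 → ι) := by
      intro m hm i hi
      have hm' : m ∈ Finset.image (Finsupp.mapDomain (![p, q] : Fin 2 → ι)) Pc.support := by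
        have := hgsupp hm
        rwa [hf, support_rename_of_injective hinj] at this
      obtain ⟨m₀, -, rfl⟩ := Finset.mem_image.mp hm'
      rw [Finsupp.mapDomain_support_of_injective hinj] at hi
      obtain ⟨k, -, rfl⟩ := Finset.mem_image.mp hi
      exact ⟨k, rfl⟩
    obtain ⟨P, hP⟩ := exists_rename_eq_of_vars_subset_range g (![p, q]) hinj (by
      intro i hi
      rw [Finset.mem_coe, mem_vars_iff_mem_support] at hi
      obtain ⟨m, hm, him⟩ := hi
      exact hvars m hm i him)
    refine ⟨P, ?_, fun z hz => ?_⟩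
    · rintro rfl
      rw [map_zero] at hP
      exact hg0 hP.symm
    · have := hgW z hz
      rw [← hP, aeval_rename, ← hcomp] at this
      exact this

end Literature.NumberTheory.Transcendental

end
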